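import Literature.Computability.FineGrained.BKGadgetPrefix
import HarnessLib

/-!
# The Bringmann–Künnemann alignment gadget: the upper bound (structured alignments)

K. Bringmann, M. Künnemann, *Quadratic conditional lower bounds for string problems and dynamic
time warping*, FOCS 2015 (arXiv:1502.01063), §5.2, proof of Lemma 5.4, first half
("We now show the upper bound …"), for `c_subst = 1`: for every structured alignment
`{(Δ+1,1),…,(Δ+m,m)}`,
`editDist x y ≤ C + ∑ⱼ editDist x_{Δ+j} yⱼ` with `C = 2nγ₃ - β(n-m)(γ₄+γ₂)`.

The printed proof is followed literally: partition `x = x(Lʸ) · G(x_{Δ+1}) 0^{γ₂} ⋯ G(x_{Δ+m}) · x(Rʸ)`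
along `y = Lʸ · G(y₁) 0^{γ₂} ⋯ G(y_m) · Rʸ` (`Params.gadgetX_split3`), concatenate traversals
(`editDist_append_append_le`, the easy half of Fact 5.7), use Lemma 5.8 with equality for
`x(Lʸ)`, `x(Rʸ)` (`Params.editDist_flatten_blocks_zeros`, `…blocks'_zeros`), match the separators
`0^{γ₂}` at cost `0` and cancel the guards (`Params.editDist_guard_guard`):
`editDist_gadgetX_gadgetX_le_sum`, `editDist_gadget_le_of_split` (list form) and
`editDist_gadget_le_structuredCost` (the form of `alignmentGadget_editDist`, part (i)).
-/

namespace Literature.Computability.FineGrained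

open Cryptography

namespace BKGadget

namespace Params

variable (P : Params)

/-- Matching block by block: for equally many inputs on both sides,
`editDist (G(b₁)0^{γ₂}⋯G(b_m)) (G(y₁)0^{γ₂}⋯G(y_m)) ≤ ∑ⱼ editDist bⱼ yⱼ` (BK15, proof of Lemma 5.4:
"`editDist(Z_{Δ+j}ˣ, Zⱼʸ) = 0`" and "`editDist(G(x_{Δ+j}), G(y_j)) ≤ editDist(x_{Δ+j}, y_j)`").
[cite: BringmannKunnemannFOCS2015, Lemma 5.4 (proof)] -/
theorem editDist_gadgetX_gadgetX_le_sum (bs ys : List (List Bool)) (h : bs.length = ys.length) :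
    editDist (P.gadgetX bs) (P.gadgetX ys) ≤ (List.zipWith editDist bs ys).sum := by
  induction bs generalizing ys with
  | nil =>
      rcases ys with _ | ⟨y, ys⟩
      · simp
      · simp at h
  | cons b bs ih =>
      rcases ys with _ | ⟨y, ys⟩
      · simp at h
      · have h' : bs.length = ys.length := by simpa using h
        rcases bs with _ | ⟨b', bs'⟩
        · rcases ys with _ | ⟨y', ys'⟩
          · simp [editDist_guard_guard]
          · simp at h'
        · rcases ys with _ | ⟨y', ys'⟩
          · simp at h'
          · have ih' := ih (y' :: ys') h'
            rw [P.gadgetX_cons b (List.cons_ne_nil _ _), P.gadgetX_cons y (List.cons_ne_nil _ _),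
              List.zipWith_cons_cons, List.sum_cons]
            refine (editDist_append_append_le _ _ _ _).trans ?_
            rw [editDist_append_right_cancel, editDist_guard_guard]
            omega

/-- `y = 0^{nγ₃} · (G(y₁) 0^{γ₂} ⋯ G(y_m)) · 0^{nγ₃}`: the middle part of `y` is the `x`-construction
applied to the `yⱼ`. [cite: BringmannKunnemannFOCS2015, Lemma 5.3] -/
theorem gadgetY_eq (n : ℕ) (ys : List (List Bool)) :
    P.gadgetY n ys = zeros (n * P.γ₃) ++ P.gadgetX ys ++ zeros (n * P.γ₃) := rfl

/-- One block is short compared to `γ₃`: `5(4γ₁ + sₓ) ≤ γ₃` (so that `|x| ≤ nγ₃ = |Lʸ|`, BK15,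
proof of Lemma 5.8: "the parameter `γ₃` is chosen such that `|x'| ≤ |x| ≤ |Lʸ|`").
[cite: BringmannKunnemannFOCS2015, Lemma 5.8 (proof)] -/
theorem block_le_γ₃ : 5 * (4 * P.γ₁ + P.sx) ≤ P.γ₃ := by
  simp only [γ₃, γ₂, γ₁]; omega

/-- **Lemma 5.4, upper bound, list form** (Bringmann–Künnemann, FOCS 2015): for inputs
`x₁…x_n = as ++ bs ++ cs` of type `(ℓₓ, sₓ)` and `y₁…y_m` with `m = |bs| ≥ 1`,
`editDist x y + 4(n-m)(4γ₁+sₓ) ≤ 2nγ₃ + ∑ⱼ editDist bⱼ yⱼ`, i.e.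
`editDist x y ≤ C + δ(structured alignment with Δ = |as|)`. [cite: BringmannKunnemannFOCS2015, Lemma 5.4] -/
theorem editDist_gadget_le_of_split (as bs cs ys : List (List Bool)) (hbs : bs ≠ [])
    (hlen : bs.length = ys.length)
    (hxlen : ∀ z ∈ as ++ bs ++ cs, z.length = P.ℓx) (hxcnt : ∀ z ∈ as ++ bs ++ cs, z.count true = P.sx) :
    editDist (P.gadgetX (as ++ bs ++ cs)) (P.gadgetY (as.length + bs.length + cs.length) ys) +
        4 * ((as.length + cs.length) * (4 * P.γ₁ + P.sx)) ≤
      2 * ((as.length + bs.length + cs.length) * P.γ₃) + (List.zipWith editDist bs ys).sum := by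
  obtain ⟨N, hN⟩ : ∃ N, N = (as.length + bs.length + cs.length) * P.γ₃ := ⟨_, rfl⟩
  have hblk := P.block_le_γ₃
  have has_len : ∀ z ∈ as, z.length = P.ℓx := fun z hz => hxlen z (by simp [hz])
  have has_cnt : ∀ z ∈ as, z.count true = P.sx := fun z hz => hxcnt z (by simp [hz])
  have hcs_len : ∀ z ∈ cs, z.length = P.ℓx := fun z hz => hxlen z (by simp [hz])
  have hcs_cnt : ∀ z ∈ cs, z.count true = P.sx := fun z hz => hxcnt z (by simp [hz])
  -- the three parts of `x`; the outer two are shorter than `N`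
  have hpre_len : (as.map fun z => P.guard z ++ zeros P.γ₂).flatten.length ≤ N := by
    rw [P.length_flatten_map_guard_append_zeros as has_len, hN]
    calc as.length * (5 * (4 * P.γ₁ + P.sx))
        ≤ (as.length + bs.length + cs.length) * (5 * (4 * P.γ₁ + P.sx)) :=
          Nat.mul_le_mul_right _ (by omega)
      _ ≤ (as.length + bs.length + cs.length) * P.γ₃ := Nat.mul_le_mul_left _ hblk
  have hsuf_len : (cs.map fun z => zeros P.γ₂ ++ P.guard z).flatten.length ≤ N := by
    rw [P.length_flatten_map_zeros_append_guard cs hcs_len, hN]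
    calc cs.length * (5 * (4 * P.γ₁ + P.sx))
        ≤ (as.length + bs.length + cs.length) * (5 * (4 * P.γ₁ + P.sx)) :=
          Nat.mul_le_mul_right _ (by omega)
      _ ≤ (as.length + bs.length + cs.length) * P.γ₃ := Nat.mul_le_mul_left _ hblk
  have h1 := P.editDist_flatten_blocks_zeros as has_len has_cnt N hpre_len
  have h2 := P.editDist_flatten_blocks'_zeros cs hcs_len hcs_cnt N hsuf_len
  have h3 := P.editDist_gadgetX_gadgetX_le_sum bs ys hlen
  have h4 := editDist_append_append_le
    ((as.map fun z => P.guard z ++ zeros P.γ₂).flatten ++ P.gadgetX bs) (zeros N ++ P.gadgetX ys)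
    (cs.map fun z => zeros P.γ₂ ++ P.guard z).flatten (zeros N)
  have h5 := editDist_append_append_le (as.map fun z => P.guard z ++ zeros P.γ₂).flatten (zeros N)
    (P.gadgetX bs) (P.gadgetX ys)
  rw [P.gadgetX_split3 as hbs cs, gadgetY_eq, ← hN, Nat.add_mul]
  omega

end Params

/-! ### Part (i) of `alignmentGadget_editDist` -/

/-- The middle inputs `x_Δ, …, x_{Δ+m-1}` (0-based) as a list: dropping `Δ` and taking `m` entries
of `[x₀,…,x_{n-1}]` gives `[x_{Δ+j}]_{j<m}`. [folklore] -/
theorem take_drop_ofFn_eq {n m : ℕ} (x : Fin n → List Bool) (Δ : ℕ) (hΔ : Δ + m ≤ n) :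
    ((List.ofFn x).drop Δ).take m = List.ofFn fun j : Fin m => x ⟨Δ + j, by omega⟩ := by
  apply List.ext_getElem
  · simp; omega
  · intro i h₁ h₂
    simp [List.getElem_take, List.getElem_drop, List.getElem_ofFn]

/-- The sum `∑ⱼ editDist bⱼ yⱼ` over the middle inputs is the structured cost. [folklore] -/
theorem sum_zipWith_eq_structuredCost {n m : ℕ} (x : Fin n → List Bool) (y : Fin m → List Bool)
    (Δ : ℕ) (hΔ : Δ + m ≤ n) :
    (List.zipWith editDist (((List.ofFn x).drop Δ).take m) (List.ofFn y)).sum =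
      structuredCost x y Δ hΔ := by
  rw [take_drop_ofFn_eq x Δ hΔ, structuredCost]
  have : List.zipWith editDist (List.ofFn fun j : Fin m => x ⟨Δ + j, by omega⟩) (List.ofFn y) =
      List.ofFn fun j : Fin m => editDist (x ⟨Δ + j, by omega⟩) (y j) := by
    apply List.ext_getElem
    · simp
    · intro i h₁ h₂
      simp [List.getElem_zipWith, List.getElem_ofFn]
  rw [this, List.sum_ofFn]

/-- **Lemma 5.4, part (i)** (Bringmann–Künnemann, FOCS 2015, upper bound of Def. 3.1 for the gadget
of Lemma 5.3 with `c_subst = 1`): for `1 ≤ m ≤ n`, inputs `xᵢ` of type `(ℓₓ, sₓ)` and every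
structured alignment `Δ` (`Δ + m ≤ n`), `editDist x y ≤ C + ∑_{j<m} editDist x_{Δ+j} yⱼ`.
[cite: BringmannKunnemannFOCS2015, Lemma 5.4] -/
theorem editDist_gadget_le_structuredCost (n m : ℕ) (P : Params) (x : Fin n → List Bool)
    (y : Fin m → List Bool) (hm : 1 ≤ m)
    (hxlen : ∀ i, (x i).length = P.ℓx) (hxcnt : ∀ i, (x i).count true = P.sx)
    (Δ : ℕ) (hΔ : Δ + m ≤ n) :
    editDist (P.gadgetX (List.ofFn x)) (P.gadgetY n (List.ofFn y)) ≤
      P.C n m + structuredCost x y Δ hΔ := by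
  have hsplit : List.ofFn x = (List.ofFn x).take Δ ++ ((List.ofFn x).drop Δ).take m ++
      (List.ofFn x).drop (Δ + m) := by
    rw [List.append_assoc, ← List.drop_drop, List.take_append_drop, List.take_append_drop]
  have hla : ((List.ofFn x).take Δ).length = Δ := by simp; omega
  have hlb : (((List.ofFn x).drop Δ).take m).length = m := by simp; omega
  have hlc : ((List.ofFn x).drop (Δ + m)).length = n - (Δ + m) := by simp
  have hmem : ∀ z ∈ (List.ofFn x).take Δ ++ ((List.ofFn x).drop Δ).take m ++ (List.ofFn x).drop (Δ + m),
      z.length = P.ℓx ∧ z.count true = P.sx := by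
    rw [← hsplit]; intro z hz
    obtain ⟨i, rfl⟩ := (List.mem_ofFn' _ _).1 hz
    exact ⟨hxlen i, hxcnt i⟩
  have h := P.editDist_gadget_le_of_split ((List.ofFn x).take Δ) (((List.ofFn x).drop Δ).take m)
    ((List.ofFn x).drop (Δ + m)) (List.ofFn y) (List.ne_nil_of_length_pos (by omega))
    (by rw [hlb, List.length_ofFn]) (fun z hz => (hmem z hz).1) (fun z hz => (hmem z hz).2)
  rw [← hsplit, hla, hlb, hlc, sum_zipWith_eq_structuredCost x y Δ hΔ,
    show Δ + m + (n - (Δ + m)) = n by omega, show Δ + (n - (Δ + m)) = n - m by omega] at h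
  have hC : P.C n m + 4 * ((n - m) * (4 * P.γ₁ + P.sx)) = 2 * (n * P.γ₃) := by
    have := P.C_add n m
    simp only [Params.γ₃]
    linarith
  omega

end BKGadget

end Literature.Computability.FineGrained
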